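import Summits.Ventures.CertifiedArithmetic.Expansions.WeakExpansion
import Literature.ComputerArithmetic.Shewchuk1997.ScaleExpansion

/-!
# Weakly nonoverlapping expansions, part 7 (§12.1–12.2): levels, and Lemma 20 for weak pairs

HONEST FRAMING (ENGINES group, unit `eng-quad-4`, kernels lane of the `certquad` engine — shared
numerical engines serving client cells; rigour lives in the verifiers; every published number
belongs to a client cell's ledger, not to the engines group): NEW WORK of the lane's Lean line, not a
published result, hence under `Summits/Ventures/` with no citation tag; nothing here is cited anywhere
as a literature fact.  The class W of WEAKLY NONOVERLAPPING expansions (`IsWeakExpansion`: every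
earlier component 2-below every later one, or 1-below it and a one-bit number; no component adjacent
to two others), its evidence and Theorems 1–2 (FAST-EXPANSION-SUM is composable on W under
round-to-even) are parts 1–6, `WeakExpansion*.lean` in this directory (overview: module docstring of
`WeakExpansion.lean`, §1–§11).  Parts 7–8 add §12, THEOREM 3: SCALE-EXPANSION (Shewchuk's Theorem 19,
`Literature/ComputerArithmetic/Shewchuk1997/ScaleExpansion.lean`) maps W into W under round-to-even —
statement, proof outline and evidence in the module docstring of part 8, `WeakExpansionScale.lean`.
This file introduces no definitions.

CONTENTS (the two ingredients of Theorem 3 that are not in Theorem 19).  §12.1 LEVELS: a one-bit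
number `±2^c` that is nonoverlapping with but adjacent to a one-bit number `±2^c'` has `c' = c + 1`
(`eq_add_one_of_below_one_of_not_below_two`); a weakly nonoverlapping expansion never has
adjacencies at two consecutive levels — a one-bit component `±2^a` followed by a component adjacent
to it AND a one-bit component `±2^(a+1)` followed by a component adjacent to it
(`IsWeakExpansion.not_two_levels`: the upper partner of the level-`a` pair would be `±2^(a+1)` itself
and adjacent to two components, or magnitudes would decrease); hence (`isWeakExpansion_of_pairwise_levels`)
a list in which every component is 2-below every later one, OR 1-below it and a one-bit number
`±2^(a+kb)` for a level `a` at which some weakly nonoverlapping `e` has an adjacency, is itself weakly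
nonoverlapping.  §12.2: the two-product of a ONE-BIT component is exact
(`twoProduct_err_eq_zero_of_abs_eq_two_zpow`: `x = ±2^a` gives `x·b = ±M_b·2^(a+kb) ∈ F`, `tᵢ = 0`),
so Lemma 20 holds for weak pairs in its nonadjacent form (`below_two_err_mul_of_weakBelow`); and the
common-grid step of Theorem 19's proof, parametrised (`exists_grid_of_below`).
-/

namespace Summit.Ventures.CertifiedArithmetic.Expansions

open Literature.ComputerArithmetic.JeannerodRump2018
open Literature.ComputerArithmetic.BoldoJeannerodMelquiondMuller2023 hiding twoSum twoSum_fst isFloat_twoSum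
open Literature.ComputerArithmetic.JoldesMullerPopescu2017 (abs_fl_le_of_abs_le)
open Literature.ComputerArithmetic.Shewchuk1997

variable {p : ℕ} {emin : ℤ} {fl : ℚ → ℚ}

/-! ### §12.1  Levels: one-bit numbers and adjacency -/

/-- A number `c`-below a nonzero `v` has `c|u| < |v|`. -/
theorem below_mul_abs_lt {c u v : ℚ} (h : Below c u v) (hv : v ≠ 0) : c * |u| < |v| := by
  obtain ⟨s, hs, hlt⟩ := h
  exact hlt.trans_le (hs.two_zpow_le_abs hv)

/-- A one-bit number `±2^c` lies on the grid `2^c`. -/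
theorem onGrid_of_abs_eq_two_zpow {v : ℚ} {c : ℤ} (hv : |v| = (2 : ℚ) ^ c) : OnGrid c v := by
  rcases (abs_eq (zpow_pos (by norm_num : (0 : ℚ) < 2) c).le).mp hv with h | h
  · exact ⟨1, by rw [h]; simp⟩
  · exact ⟨-1, by rw [h]; simp⟩

/-- `±2^a` is never 2-below `±2^(a+1)` (they are adjacent). -/
theorem not_below_two_of_abs_eq {x u : ℚ} {a : ℤ} (hx : |x| = (2 : ℚ) ^ a)
    (hu : |u| = (2 : ℚ) ^ (a + 1)) : ¬ Below 2 x u := fun h => by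
  have hu0 : u ≠ 0 := abs_pos.mp (by rw [hu]; exact zpow_pos (by norm_num) _)
  have := below_mul_abs_lt h hu0
  rw [hx, hu, zpow_add_one₀ (by norm_num : (2 : ℚ) ≠ 0)] at this
  linarith

/-- `±2^(a+1)` is never 1-below `±2^a` (magnitudes decrease). -/
theorem not_below_one_of_abs_eq {z x : ℚ} {a : ℤ} (hz : |z| = (2 : ℚ) ^ (a + 1))
    (hx : |x| = (2 : ℚ) ^ a) : ¬ Below 1 z x := fun h => by
  have hx0 : x ≠ 0 := abs_pos.mp (by rw [hx]; exact zpow_pos (by norm_num) _)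
  have := below_mul_abs_lt h hx0
  rw [hx, hz, zpow_add_one₀ (by norm_num : (2 : ℚ) ≠ 0)] at this
  linarith [zpow_pos (by norm_num : (0 : ℚ) < 2) a]

/-- Two one-bit numbers `±2^c`, `±2^c'` that are nonoverlapping but adjacent sit at consecutive
levels: `c' = c + 1`. -/
theorem eq_add_one_of_below_one_of_not_below_two {u v : ℚ} {c c' : ℤ} (h1 : Below 1 u v)
    (h2 : ¬ Below 2 u v) (hu : |u| = (2 : ℚ) ^ c) (hv : |v| = (2 : ℚ) ^ c') : c' = c + 1 := by
  have h20 : (0 : ℚ) < 2 := by norm_num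
  have hv0 : v ≠ 0 := abs_pos.mp (by rw [hv]; exact zpow_pos h20 _)
  have hlt : c < c' := by
    have := below_mul_abs_lt h1 hv0
    rw [one_mul, hu, hv] at this
    exact (zpow_lt_zpow_iff_right₀ (by norm_num : (1 : ℚ) < 2)).mp this
  have hle : c' ≤ c + 1 := by
    by_contra hlt'
    refine h2 ⟨c', onGrid_of_abs_eq_two_zpow hv, ?_⟩
    rw [hu, mul_comm, ← zpow_add_one₀ h20.ne']
    exact zpow_lt_zpow_right₀ (by norm_num) (by omega)
  omega

/-- **No two consecutive adjacency levels.**  A weakly nonoverlapping expansion cannot contain a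
one-bit component `±2^a` followed by a component it is adjacent to AND a one-bit component
`±2^(a+1)` followed by a component it is adjacent to. -/
theorem IsWeakExpansion.not_two_levels {a : ℤ} : ∀ {l : List ℚ}, IsWeakExpansion l →
    ¬ (l.Pairwise fun x y => |x| = (2 : ℚ) ^ a → Below 2 x y) →
    ¬ (l.Pairwise fun x y => |x| = (2 : ℚ) ^ (a + 1) → Below 2 x y) → False
  | [], _, ha, _ => ha List.Pairwise.nil
  | z :: l, hW, ha, ha1 => by
    obtain ⟨hzb, hnd, hl⟩ := isWeakExpansion_cons.mp hW
    rw [List.pairwise_cons] at ha ha1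
    by_cases ht : l.Pairwise fun x y => |x| = (2 : ℚ) ^ a → Below 2 x y
    · -- the level-`a` pair starts at the head: `|z| = 2^a`
      obtain ⟨y, -, hza, -⟩ : ∃ y ∈ l, |z| = (2 : ℚ) ^ a ∧ ¬ Below 2 z y := by
        by_contra hh; push Not at hh; exact ha ⟨hh, ht⟩
      by_cases ht1 : l.Pairwise fun x y => |x| = (2 : ℚ) ^ (a + 1) → Below 2 x y
      · obtain ⟨y', -, hza1, -⟩ : ∃ y ∈ l, |z| = (2 : ℚ) ^ (a + 1) ∧ ¬ Below 2 z y := by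
          by_contra hh; push Not at hh; exact ha1 ⟨hh, ht1⟩
        have := zpow_right_injective₀ (by norm_num : (0 : ℚ) < 2) (by norm_num : (2 : ℚ) ≠ 1)
          (hza.symm.trans hza1)
        omega
      · -- a level-`(a+1)` pair `u, v` in the tail: `u = ±2^(a+1)` is adjacent to `z` and to `v`
        refine ht1 (hnd.imp fun {u v} huv hu => huv.elim (fun hzu => ?_) id)
        exact absurd hzu (not_below_two_of_abs_eq hza hu)
    · by_cases ht1 : l.Pairwise fun x y => |x| = (2 : ℚ) ^ (a + 1) → Below 2 x y
      · -- the level-`(a+1)` pair starts at the head, a level-`a` one-bit `x` comes later: order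
        obtain ⟨y', -, hza1, -⟩ : ∃ y ∈ l, |z| = (2 : ℚ) ^ (a + 1) ∧ ¬ Below 2 z y := by
          by_contra hh; push Not at hh; exact ha1 ⟨hh, ht1⟩
        refine ht (hl.1.imp_of_mem fun {x y} hx _ _ hxa => ?_)
        exact absurd (hzb x hx).below_one (not_below_one_of_abs_eq hza1 hxa)
      · exact IsWeakExpansion.not_two_levels hl ht ht1

/-- **From levels to the class W.**  If every component of `l` is 2-below every later one, or is
1-below it and a one-bit number `±2^(a+kb)` for a level `a` at which the weakly nonoverlapping `e`
has an adjacency, then `l` is weakly nonoverlapping. -/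
theorem isWeakExpansion_of_pairwise_levels {e : List ℚ} (he : IsWeakExpansion e) {kb : ℤ} :
    ∀ {l : List ℚ}, (l.Pairwise fun u v => Below 2 u v ∨ (Below 1 u v ∧ ∃ a : ℤ,
        |u| = (2 : ℚ) ^ (a + kb) ∧ ¬ e.Pairwise fun x y => |x| = (2 : ℚ) ^ a → Below 2 x y)) →
      IsWeakExpansion l
  | [], _ => isWeakExpansion_nil
  | u :: l, h => by
    obtain ⟨hu, hl⟩ := List.pairwise_cons.mp h
    refine isWeakExpansion_cons.mpr ⟨fun v hv => ?_, ?_, isWeakExpansion_of_pairwise_levels he hl⟩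
    · rcases hu v hv with h2 | ⟨h1, a, hua, -⟩
      · exact Or.inl h2
      · exact Or.inr ⟨h1, a + kb, hua⟩
    · refine hl.imp_of_mem fun {v w} hv _ hvw => ?_
      by_cases hb2 : Below 2 u v
      · exact Or.inl hb2
      rcases hvw with h2' | ⟨-, a', hva, hlev'⟩
      · exact Or.inr h2'
      rcases hu v hv with h2 | ⟨h1, a, hua, hlev⟩
      · exact absurd h2 hb2
      have haa : a' + kb = a + kb + 1 := eq_add_one_of_below_one_of_not_below_two h1 hb2 hua hva
      rw [show a' = a + 1 by omega] at hlev'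
      exact (he.not_two_levels hlev hlev').elim

/-- The level record is monotone in the input list. -/
theorem pairwise_levels_mono {kb : ℤ} (x : ℚ) {xs l : List ℚ}
    (h : l.Pairwise fun u v => Below 2 u v ∨ (Below 1 u v ∧ ∃ a : ℤ,
      |u| = (2 : ℚ) ^ (a + kb) ∧ ¬ xs.Pairwise fun x y => |x| = (2 : ℚ) ^ a → Below 2 x y)) :
    l.Pairwise fun u v => Below 2 u v ∨ (Below 1 u v ∧ ∃ a : ℤ,
      |u| = (2 : ℚ) ^ (a + kb) ∧ ¬ (x :: xs).Pairwise fun x y => |x| = (2 : ℚ) ^ a → Below 2 x y) :=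
  h.imp fun huv => huv.imp_right fun ⟨hb1, a, hua, hlev⟩ =>
    ⟨hb1, a, hua, fun hpw => hlev (List.pairwise_cons.mp hpw).2⟩

/-! ### §12.2  The two-product of a one-bit component, and the common grid -/

/-- If `|x| = 2^a` is a one-bit number of `F_p ∩ 2^(emin−kb)·F` then `x·b = ±M_b·2^(a+kb)` is a float
and the two-product has no error: `tᵢ = 0`. -/
theorem twoProduct_err_eq_zero_of_abs_eq_two_zpow (hfl : IsRoundNearest p emin fl) {b : ℚ}
    {Mb kb : ℤ} (hbrep : b = (Mb : ℚ) * 2 ^ kb) (hMb : |Mb| < 2 ^ p) {x T t : ℚ} {a : ℤ}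
    (hxU : IsFloat p (emin - kb) x) (hxa : |x| = (2 : ℚ) ^ a) (hT : T = fl (x * b))
    (hTt : T + t = x * b) : t = 0 := by
  have h20 : (0 : ℚ) < 2 := by norm_num
  obtain ⟨M, k, hM, hk, hxe⟩ := hxU
  have hx0 : x ≠ 0 := abs_pos.mp (by rw [hxa]; exact zpow_pos h20 a)
  have hka : k ≤ a := by
    have hM0 : M ≠ 0 := by rintro rfl; simp [hxe] at hx0
    have h1 : (1 : ℚ) ≤ |(M : ℚ)| := by rw [← Int.cast_abs]; exact_mod_cast Int.one_le_abs hM0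
    have : (2 : ℚ) ^ k ≤ (2 : ℚ) ^ a := by
      rw [← hxa, hxe, abs_mul, abs_of_pos (zpow_pos h20 k)]
      exact le_mul_of_one_le_left (zpow_pos h20 k).le h1
    exact (zpow_le_zpow_iff_right₀ (by norm_num : (1 : ℚ) < 2)).mp this
  have hprodF : IsFloat p emin (x * b) := by
    rcases (abs_eq (zpow_pos h20 a).le).mp hxa with h | h
    · have : x * b = ((Mb : ℤ) : ℚ) * (2 : ℚ) ^ (a + kb) := by
        rw [h, hbrep, zpow_add₀ h20.ne']; ring
      rw [this]; exact isFloat_of_int_mul _ _ hMb (by omega)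
    · have : x * b = ((-Mb : ℤ) : ℚ) * (2 : ℚ) ^ (a + kb) := by
        rw [h, hbrep, zpow_add₀ h20.ne']; push_cast; ring
      rw [this]; exact isFloat_of_int_mul _ _ (by rwa [abs_neg]) (by omega)
  have : t = x * b - T := by linarith
  rw [this, hT, fl_eq_self hfl hprodF, sub_self]

/-- **Lemma 20 for weak pairs.**  If `x` is weakly below `y` then the two-product error `tᵢ` of
`x·b` is 2-below (nonadjacent to) the later product `y·b`. -/
theorem below_two_err_mul_of_weakBelow (hp : 1 ≤ p) (hfl : IsRoundNearest p emin fl) {b : ℚ}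
    {Mb kb : ℤ} (hbrep : b = (Mb : ℚ) * 2 ^ kb) (hMb : |Mb| < 2 ^ p) {x y T t : ℚ}
    (hxU : IsFloat p (emin - kb) x) (hyU : IsFloat p (emin - kb) y) (hxy : WeakBelow x y)
    (hT : T = fl (x * b)) (hTt : T + t = x * b) : Below 2 t (y * b) := by
  rcases hxy with hb2 | ⟨-, a, hxa⟩
  · exact below_twoProduct_err_mul hp hfl (Or.inr rfl) hbrep hMb hxU hyU hb2 hT hTt
  · rw [twoProduct_err_eq_zero_of_abs_eq_two_zpow hfl hbrep hMb hxU hxa hT hTt]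
    exact below_zero_left (isFloat_two_mul_prod hbrep hMb hyU) 2

/-- **The common grid** (Theorem 19's "hence, the component cannot overlap any portion of their
sum", parametrised): if `h` is `c`-below the float accumulator `Q`, the floats of `L` and every
remaining product `y·b`, then one grid `2^g ∋ Q, L, Tⱼ, tⱼ` (`g ≥ emin`) has `c|h| < 2^g`. -/
theorem exists_grid_of_below (hp : 1 ≤ p) (hfl : IsRoundNearest p emin fl) {c h b : ℚ}
    {Mb kb : ℤ} (hbrep : b = (Mb : ℚ) * 2 ^ kb) (hMb : |Mb| < 2 ^ p) {tp : ℚ → ℚ → ℚ × ℚ}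
    {xs : List ℚ} (hxsU : ∀ y ∈ xs, IsFloat p (emin - kb) y)
    (htps : ∀ y ∈ xs, (tp y b).1 = fl (y * b) ∧ (tp y b).1 + (tp y b).2 = y * b)
    {Q : ℚ} (hQF : IsFloat p emin Q) (hQ : Below c h Q)
    {L : List ℚ} (hLF : ∀ w ∈ L, IsFloat p emin w) (hL : ∀ w ∈ L, Below c h w)
    (hys : ∀ y ∈ xs, Below c h (y * b)) :
    ∃ g : ℤ, emin ≤ g ∧ c * |h| < (2 : ℚ) ^ g ∧ OnGrid g Q ∧ (∀ w ∈ L, OnGrid g w) ∧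
      ∀ y ∈ xs, OnGrid g (tp y b).1 ∧ OnGrid g (tp y b).2 := by
  obtain ⟨g₀, hg₀, hQg₀, hcg₀⟩ := hQ.normalize hQF
  have hF : ∀ w ∈ L ++ xs.map (· * b), IsFloat (p + p) emin w := by
    intro w hw
    rcases List.mem_append.mp hw with hw | hw
    · exact isFloat_widen (hLF w hw)
    · obtain ⟨y, hy, rfl⟩ := List.mem_map.mp hw
      exact isFloat_two_mul_prod hbrep hMb (hxsU y hy)
  have hB : ∀ w ∈ L ++ xs.map (· * b), Below c h w := by
    intro w hw
    rcases List.mem_append.mp hw with hw | hw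
    · exact hL w hw
    · obtain ⟨y, hy, rfl⟩ := List.mem_map.mp hw
      exact hys y hy
  obtain ⟨g, hg, hgg₀, hcg, hG⟩ := exists_common_grid hF hB hg₀ hcg₀
  refine ⟨g, hg, hcg, hQg₀.mono hgg₀, fun w hw => hG w (List.mem_append_left _ hw),
    fun y hy => ?_⟩
  have hyg : OnGrid g (y * b) :=
    hG _ (List.mem_append_right _ (List.mem_map.mpr ⟨y, hy, rfl⟩))
  obtain ⟨h1, h12⟩ := htps y hy
  have hG1 : OnGrid g (tp y b).1 := by rw [h1]; exact hyg.fl_of hp hfl hg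
  refine ⟨hG1, ?_⟩
  have : (tp y b).2 = y * b - (tp y b).1 := by linarith
  rw [this]; exact hyg.sub hG1

end Summit.Ventures.CertifiedArithmetic.Expansions
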